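import Summits.Ventures.LatticeQCDFlow.Scaling.SwapLadderIndexPoisson

/-!
HONEST FRAMING: exact (Metropolis-corrected) sampling algorithms for lattice gauge theory; figures
of merit are autocorrelation/cost numbers at stated couplings and volumes; no continuum-physics
claim.

# SwapLadderIndexTauInt — THE INTEGRATED AUTOCORRELATION TIME OF THE REPLICA INDEX ON A SWAP LADDER, EXACTLY,
# FOR EVERY ACCEPTANCE PROFILE: `τ_int = (6/(K(K+1)(K+2)))·Σ_{j<K} (j+1)²(K−j)²/a_j − 1/2` SWAP SCANS
# (Kemeny–Snell asymptotic variance `v = (1/(K+1))Σ_j w_j²/a_j − K(K+2)/12`, `τ_int = v/(2·Var)`,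
# `Var = K(K+2)/12`); FLAT LADDER: `(K² + 2K + 2)/(5a) − 1/2` (row 22 `su3-ptbc`, GEN-6, ours; part 2 of 2,
# sequel of `SwapLadderIndexPoisson`)

Venture `LatticeQCDFlow` (cell pub-lqcd), topic `Scaling`; FANOUT row 22 (`su3-ptbc`).  NEW WORK of the cell over
part 1 and the Literature finite-chain vocabulary (`PeskunOrdering`: `fundamentalMatrix π P = Z = (I − (P − A))⁻¹`,
**`asympVar f π P`** — Kemeny–Snell's closed form with the limit identity `tendsto_varSum_div` — and its centred form
`asympVar_eq_centred` `v = 2⟨f̄, Z f̄⟩_π − ‖f̄‖²_π`; `fundamentalInv_mul_fundamentalMatrix`; Mathlib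
`Matrix.mulVec_injective_iff_isUnit`).  Nothing is cited as a fact; no `native_decide`.  Setting as in part 1
(birth–death kernel with an ARBITRARY bond profile `a`, `a_j > 0`; row 22's `profileWalk` / `ladderWalk` and lean-2's
uniform-ladder lumped walks are instances, NAMED ONLY — no stale module imported).

## What is proved

§4 **`ladder_harmonic_const`** (`P d = d` ⇒ `d` constant, induction up the ladder), **`isUnit_fundamentalInv_ladder`**
   (`I − (P − A)` invertible with the uniform law: pairing with `π` kills the mean, harmonicity the rest),
   **`fundamentalMatrix_mulVec_centred_levelObs`** (`Z(k − K/2) = levelPoisson K a`).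
§5 **`asympVar_levelObs_profile`** — `v(index) = (1/(K+1))·Σ_{j<K} w_j²/a_j − K(K+2)/12`;
   **`tauInt_levelObs_profile`** — `v/(2·Var) = (6/(K(K+1)(K+2)))·Σ_{j<K} w_j²/a_j − 1/2` (`K ≥ 1`; Madras–Slade's
   `τ_int` convention (9.2.10), unit = one scan of the idealised walk): a passage-weighted HARMONIC functional of the
   pair acceptances — the `τ_int` companion of GEN-5's round trip `2(K+1)·Σ_j 1/a_j` (`SwapLadderRoundTrip`).
§6 FLAT LADDER (`a_j = c`): `sum_passageWeight_sq` (`Σ_j w_j² = K(K+1)(K+2)(K²+2K+2)/30`),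
   **`tauInt_levelObs_flat`** `= (K² + 2K + 2)/(5c) − 1/2`; READINGS (comparands NAMED ONLY, nothing imported):
   `tauInt_levelObs_flat_gt_lagOne` — `> (K+1)(K+2)/(12c) − 1/2`, the flat-ladder value of lean-2's universal lag-one
   floor `K(K+2)/(6ā_K) − ½` (`Scaling/TemperingLevelTauInt`; `ā_K = 2Kc/(K+1)`) — the exact idealised value is
   `12(K²+2K+2)/(5(K+1)(K+2)) → 2.4` times it; `tauInt_levelObs_flat_lt_gapCeiling` — `< 2K(K+1)/c − 1/2`, the value
   of lean-2's perfect-redraw spectral-gap ceiling (staged W5) — about a tenth of it; **`tauInt_levelObs_flat_twenty`**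
   — S2's ladder (`K = 12`, `c = 1/5`, CARD §2): `339/2 = 169.5` scans `≈ 21.2` macro-steps at `8` scans (a MODEL
   number, not an acceptance item).

THE DRIVER's SCHEME (NOT typed here): under the deterministic even–odd scheme (GEN-5's lifted `deoWalk`, staged) the
same method gives `τ_int = (6/(K(K+1)(K+2)))·Σ_j w_j²·r_j/s_j` (`s_j = a_j`, `r_j = 1 − a_j`; exact numerics for random
profiles, `K ≤ 12`): the two schemes differ by the PROFILE-INDEPENDENT amount `(K²+2K+2)/5 − 1/2`, exactly as their
round trips differ by `2(K+1)(K−1)` (GEN-5); the flat case `(K²+2K+2)(1−a)/(5a)` is typed in the staged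
`SwapLadderIndexTauIntDEO` (S2: `136` vs `169.5` scans).  NOT CLAIMED: that PTBC's replica index IS this walk (ELE
idealisation; the card measures `τ_int` of `Q²` at the physical rung, a different observable); anything measured.
-/

noncomputable section

open Finset Matrix
open Literature.Probability.MarkovChains

namespace Summit.Ventures.LatticeQCDFlow.Scaling

/-! ## §4 `I − (P − A)` is invertible (harmonic functions are constant), so `Z(k − K/2) = g` -/

section Fundamental

variable {K : ℕ} {a : ℕ → ℝ} {p q : ℕ → ℝ}

/-- **Harmonic functions of the ladder walk are constant** (`a_k ≠ 0` for `k < K`): `P d = d` forces all rungs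
equal. [ours] -/
theorem ladder_harmonic_const (ha : ∀ k, k < K → a k ≠ 0) (hp : ∀ k, k < K → p k = a k / 2) (hq0 : q 0 = 0)
    (hq : ∀ k, 1 ≤ k → k ≤ K → q k = a (k - 1) / 2) {d : Fin (K + 1) → ℝ}
    (hd : ∀ x, ∑ y, bdKernel K p q x y * d y = d x) (x : Fin (K + 1)) : d x = d 0 := by
  have step : ∀ n (hn : n + 1 < K + 1), d ⟨n + 1, hn⟩ = d ⟨n, by omega⟩ := by
    intro n
    induction n with
    | zero =>
      intro hn
      have hK : 0 < K := by omega
      have h0 := hd ((⟨0, hK⟩ : Fin K).castSucc)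
      rw [sum_bdKernel_mul hq0 ⟨0, hK⟩ d, hp 0 hK, hq0] at h0
      simp only [Fin.succ_mk, Fin.castSucc_mk, zero_mul, add_zero] at h0
      have h0' : a 0 / 2 * d ⟨1, hn⟩ + (1 - a 0 / 2 - 0) * d ⟨0, by omega⟩ = d ⟨0, by omega⟩ := h0
      have ha2 : a 0 / 2 ≠ 0 := div_ne_zero (ha 0 hK) two_ne_zero
      have h1 : a 0 / 2 * (d ⟨1, hn⟩ - d ⟨0, by omega⟩) = 0 := by linarith
      have h2 := (mul_eq_zero.mp h1).resolve_left ha2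
      show d ⟨1, hn⟩ = d ⟨0, _⟩
      linarith
    | succ n ih =>
      intro hn
      have hnK : n + 1 < K := by omega
      have hrow := hd ((⟨n + 1, hnK⟩ : Fin K).castSucc)
      rw [sum_bdKernel_mul hq0 ⟨n + 1, hnK⟩ d, hp (n + 1) hnK, hq (n + 1) (by omega) (by omega)] at hrow
      simp only [Fin.succ_mk, Fin.castSucc_mk, Nat.add_sub_cancel] at hrow
      have hprev := ih (by omega)
      have ha2 : a (n + 1) / 2 ≠ 0 := div_ne_zero (ha (n + 1) hnK) two_ne_zero
      have : a (n + 1) / 2 * (d ⟨n + 1 + 1, hn⟩ - d ⟨n + 1, by omega⟩)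
          = a n / 2 * (d ⟨n + 1, by omega⟩ - d ⟨n, by omega⟩) := by
        linarith
      rw [hprev, sub_self, mul_zero] at this
      have h2 := (mul_eq_zero.mp this).resolve_left ha2
      linarith
  have key : ∀ n (hn : n < K + 1), d ⟨n, hn⟩ = d 0 := by
    intro n
    induction n with
    | zero => intro hn; rfl
    | succ n ih => intro hn; rw [step n hn, ih (by omega)]
  have := key x.val x.isLt
  simpa using this

/-- **`I − (P − A)` is invertible** for the ladder walk with the uniform law (`a_k ≠ 0`). [ours] -/
theorem isUnit_fundamentalInv_ladder (ha : ∀ k, k < K → a k ≠ 0) (hp : ∀ k, k < K → p k = a k / 2)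
    (hpK : p K = 0) (hq0 : q 0 = 0) (hq : ∀ k, 1 ≤ k → k ≤ K → q k = a (k - 1) / 2) :
    IsUnit (1 - (bdKernel K p q - limitMatrix (unifLaw K))) := by
  rw [← mulVec_injective_iff_isUnit]
  intro v w hvw
  have hst := unifLaw_isStationary hp hpK hq0 hq
  set d : Fin (K + 1) → ℝ := v - w with hd
  have h0 : ∀ x, d x - ∑ y, bdKernel K p q x y * d y + ∑ y, unifLaw K y * d y = 0 := by
    intro x
    have h1 : ((1 - (bdKernel K p q - limitMatrix (unifLaw K))) *ᵥ d) x = 0 := by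
      rw [hd, mulVec_sub, hvw, sub_self]; rfl
    rwa [fundamentalInv_mulVec_apply] at h1
  set m := ∑ y, unifLaw K y * d y with hm
  have hsum : ∑ x, unifLaw K x * (∑ y, bdKernel K p q x y * d y) = m := by
    calc ∑ x, unifLaw K x * (∑ y, bdKernel K p q x y * d y)
        = ∑ y, (∑ x, unifLaw K x * bdKernel K p q x y) * d y := by
          simp_rw [mul_sum, sum_mul]
          rw [sum_comm]
          exact sum_congr rfl fun y _ => sum_congr rfl fun x _ => by ring
      _ = m := by
          rw [hm]
          exact sum_congr rfl fun y _ => by rw [hst y]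
  have hm0 : m = 0 := by
    have h2 : ∑ x, unifLaw K x * (d x - ∑ y, bdKernel K p q x y * d y + m) = 0 :=
      sum_eq_zero fun x _ => by rw [h0 x, mul_zero]
    simp_rw [mul_add, mul_sub, sum_add_distrib, sum_sub_distrib, hsum, ← sum_mul, sum_unifLaw, one_mul] at h2
    rw [← hm] at h2
    linarith
  have hharm : ∀ x, ∑ y, bdKernel K p q x y * d y = d x := fun x => by
    have := h0 x; rw [hm0] at this; linarith
  have hconst := ladder_harmonic_const ha hp hq0 hq hharm
  have hd0 : d 0 = 0 := by
    have h3 : m = d 0 := by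
      rw [hm]
      calc ∑ y, unifLaw K y * d y = ∑ y, unifLaw K y * d 0 := sum_congr rfl fun y _ => by rw [hconst y]
        _ = d 0 := by rw [← sum_mul, sum_unifLaw, one_mul]
    rw [← h3, hm0]
  funext x
  have : d x = 0 := by rw [hconst x, hd0]
  simpa [hd, sub_eq_zero] using this

/-- **`Z (k − K/2) = g`**: the fundamental matrix applied to the centred index is the centred Poisson solution
`levelPoisson K a`. [ours] -/
theorem fundamentalMatrix_mulVec_centred_levelObs (ha : ∀ k, k < K → a k ≠ 0) (hp : ∀ k, k < K → p k = a k / 2)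
    (hpK : p K = 0) (hq0 : q 0 = 0) (hq : ∀ k, 1 ≤ k → k ≤ K → q k = a (k - 1) / 2) :
    fundamentalMatrix (unifLaw K) (bdKernel K p q) *ᵥ centred (unifLaw K) (levelObs K) = levelPoisson K a := by
  have hK := isUnit_fundamentalInv_ladder ha hp hpK hq0 hq
  apply (mulVec_injective_iff_isUnit.2 hK)
  show (1 - (bdKernel K p q - limitMatrix (unifLaw K))) *ᵥ
      (fundamentalMatrix (unifLaw K) (bdKernel K p q) *ᵥ centred (unifLaw K) (levelObs K))
    = (1 - (bdKernel K p q - limitMatrix (unifLaw K))) *ᵥ levelPoisson K a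
  rw [mulVec_mulVec, fundamentalInv_mul_fundamentalMatrix hK, one_mulVec]
  funext x
  rw [fundamentalInv_mulVec_apply, sum_unifLaw_mul_levelPoisson, add_zero,
    levelPoisson_poisson ha hp hpK hq0 hq x, centred_levelObs]

end Fundamental

/-! ## §5 THE ASYMPTOTIC VARIANCE AND `τ_int` OF THE REPLICA INDEX FOR EVERY ACCEPTANCE PROFILE, EXACTLY -/

section Main

variable {K : ℕ} {a : ℕ → ℝ} {p q : ℕ → ℝ}

/-- **THE ASYMPTOTIC VARIANCE OF THE REPLICA INDEX**: for the ladder walk with ANY acceptance profile `a`,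
`v = (1/(K+1))·Σ_{j<K} w_j²/a_j − K(K+2)/12`, `w_j = (j+1)(K−j)` (Kemeny–Snell `asympVar`). [ours] -/
theorem asympVar_levelObs_profile (ha : ∀ k, k < K → 0 < a k) (hP : IsRowStochastic (bdKernel K p q))
    (hp : ∀ k, k < K → p k = a k / 2) (hpK : p K = 0) (hq0 : q 0 = 0) (hq : ∀ k, 1 ≤ k → k ≤ K → q k = a (k - 1) / 2) :
    asympVar (levelObs K) (unifLaw K) (bdKernel K p q)
      = 1 / ((K : ℝ) + 1) * ∑ j ∈ range K, passageWeight K j ^ 2 / a j - (K : ℝ) * (K + 2) / 12 := by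
  have ha' : ∀ k, k < K → a k ≠ 0 := fun k hk => (ha k hk).ne'
  rw [asympVar_eq_centred (sum_unifLaw K) hP (unifLaw_isStationary hp hpK hq0 hq)
    (isUnit_fundamentalInv_ladder ha' hp hpK hq0 hq), fundamentalMatrix_mulVec_centred_levelObs ha' hp hpK hq0 hq,
    piInner_centred_levelObs_levelPoisson, piInner_centred_levelObs]
  rw [mul_sum, mul_sum, mul_sum]
  congr 1
  refine sum_congr rfl fun j hj => ?_
  have := (ha j (mem_range.mp hj)).ne'
  field_simp

/-- **THE INTEGRATED AUTOCORRELATION TIME OF THE REPLICA INDEX, FOR EVERY ACCEPTANCE PROFILE**: with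
`τ_int = v/(2·Var)` (Madras–Slade (9.2.10); `Var = K(K+2)/12`, `K ≥ 1`),
`τ_int = (6/(K(K+1)(K+2)))·Σ_{j<K} (j+1)²(K−j)²/a_j − 1/2` swap scans — a passage-weighted HARMONIC functional of
the pair acceptances, the `τ_int` companion of GEN-5's round trip `2(K+1)·Σ_j 1/a_j`. [ours] -/
theorem tauInt_levelObs_profile (ha : ∀ k, k < K → 0 < a k) (hK : 1 ≤ K) (hP : IsRowStochastic (bdKernel K p q))
    (hp : ∀ k, k < K → p k = a k / 2) (hpK : p K = 0) (hq0 : q 0 = 0) (hq : ∀ k, 1 ≤ k → k ≤ K → q k = a (k - 1) / 2) :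
    asympVar (levelObs K) (unifLaw K) (bdKernel K p q)
        / (2 * piInner (unifLaw K) (centred (unifLaw K) (levelObs K)) (centred (unifLaw K) (levelObs K)))
      = 6 / ((K : ℝ) * (K + 1) * (K + 2)) * ∑ j ∈ range K, passageWeight K j ^ 2 / a j - 1 / 2 := by
  rw [asympVar_levelObs_profile ha hP hp hpK hq0 hq, piInner_centred_levelObs]
  have hK0 : (0 : ℝ) < K := by exact_mod_cast hK
  have h1 : (K : ℝ) * (K + 2) ≠ 0 := by positivity
  have h2 : (K : ℝ) + 1 ≠ 0 := by positivity
  field_simp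
  ring

end Main

/-! ## §6 The flat ladder (`a_j = a`): `τ_int = (K² + 2K + 2)/(5a) − 1/2`; readings; S2's ladder -/

section Flat

variable {K : ℕ} {a : ℕ → ℝ} {p q : ℕ → ℝ}

/-- `Σ_{j<K} w_j² = K(K+1)(K+2)(K²+2K+2)/30`. [ours] -/
theorem sum_passageWeight_sq (K : ℕ) :
    ∑ j ∈ range K, passageWeight K j ^ 2 = (K : ℝ) * (K + 1) * (K + 2) * ((K : ℝ) ^ 2 + 2 * K + 2) / 30 := by
  have e : ∑ j ∈ range K, passageWeight K j ^ 2
      = ∑ j ∈ range K, ((K : ℝ) ^ 2 + (2 * (K : ℝ) ^ 2 - 2 * K) * (j : ℝ) + ((K : ℝ) ^ 2 - 4 * K + 1) * (j : ℝ) ^ 2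
        + (2 - 2 * (K : ℝ)) * (j : ℝ) ^ 3 + 1 * (j : ℝ) ^ 4) := sum_congr rfl fun j _ => by
    simp only [passageWeight]; ring
  rw [e, sum_range_poly4]
  ring

/-- **FLAT LADDER: `τ_int = (K² + 2K + 2)/(5a) − 1/2` scans** (`a_j = c` for `j < K`, `0 < c`, `K ≥ 1`). [ours] -/
theorem tauInt_levelObs_flat {c : ℝ} (hc : 0 < c) (hac : ∀ k, k < K → a k = c) (hK : 1 ≤ K)
    (hP : IsRowStochastic (bdKernel K p q)) (hp : ∀ k, k < K → p k = a k / 2) (hpK : p K = 0) (hq0 : q 0 = 0)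
    (hq : ∀ k, 1 ≤ k → k ≤ K → q k = a (k - 1) / 2) :
    asympVar (levelObs K) (unifLaw K) (bdKernel K p q)
        / (2 * piInner (unifLaw K) (centred (unifLaw K) (levelObs K)) (centred (unifLaw K) (levelObs K)))
      = ((K : ℝ) ^ 2 + 2 * K + 2) / (5 * c) - 1 / 2 := by
  rw [tauInt_levelObs_profile (fun k hk => by rw [hac k hk]; exact hc) hK hP hp hpK hq0 hq]
  have e : ∑ j ∈ range K, passageWeight K j ^ 2 / a j = (∑ j ∈ range K, passageWeight K j ^ 2) / c := by
    rw [sum_div]; exact sum_congr rfl fun j hj => by rw [hac j (mem_range.mp hj)]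
  rw [e, sum_passageWeight_sq]
  have hK0 : (0 : ℝ) < K := by exact_mod_cast hK
  field_simp
  ring

/-- **The flat-ladder value exceeds `(K+1)(K+2)/(12c) − 1/2`** (the flat-ladder value of lean-2's universal lag-one
floor, named only). [ours] -/
theorem tauInt_levelObs_flat_gt_lagOne {c : ℝ} (hc : 0 < c) (hac : ∀ k, k < K → a k = c) (hK : 1 ≤ K)
    (hP : IsRowStochastic (bdKernel K p q)) (hp : ∀ k, k < K → p k = a k / 2) (hpK : p K = 0) (hq0 : q 0 = 0)
    (hq : ∀ k, 1 ≤ k → k ≤ K → q k = a (k - 1) / 2) :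
    ((K : ℝ) + 1) * (K + 2) / (12 * c) - 1 / 2 <
      asympVar (levelObs K) (unifLaw K) (bdKernel K p q)
        / (2 * piInner (unifLaw K) (centred (unifLaw K) (levelObs K)) (centred (unifLaw K) (levelObs K))) := by
  rw [tauInt_levelObs_flat hc hac hK hP hp hpK hq0 hq]
  have hK0 : (0 : ℝ) < K := by exact_mod_cast hK
  rw [sub_lt_sub_iff_right, div_lt_div_iff₀ (by positivity) (by positivity)]
  nlinarith

/-- **… and is below `2K(K+1)/c − 1/2`** (the flat-ladder value of the perfect-redraw spectral-gap ceiling, named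
only). [ours] -/
theorem tauInt_levelObs_flat_lt_gapCeiling {c : ℝ} (hc : 0 < c) (hac : ∀ k, k < K → a k = c) (hK : 1 ≤ K)
    (hP : IsRowStochastic (bdKernel K p q)) (hp : ∀ k, k < K → p k = a k / 2) (hpK : p K = 0) (hq0 : q 0 = 0)
    (hq : ∀ k, 1 ≤ k → k ≤ K → q k = a (k - 1) / 2) :
    asympVar (levelObs K) (unifLaw K) (bdKernel K p q)
        / (2 * piInner (unifLaw K) (centred (unifLaw K) (levelObs K)) (centred (unifLaw K) (levelObs K)))
      < 2 * (K : ℝ) * (K + 1) / c - 1 / 2 := by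
  rw [tauInt_levelObs_flat hc hac hK hP hp hpK hq0 hq]
  have hK0 : (1 : ℝ) ≤ K := by exact_mod_cast hK
  rw [sub_lt_sub_iff_right, div_lt_div_iff₀ (by positivity) hc]
  nlinarith

/-- **S2's ladder** (CARD §2: `N_r = 13`, flat `20 %`): `K = 12`, `a_j = 1/5` ⇒ index `τ_int = 339/2 = 169.5` scans
(`≈ 21.2` macro-steps at `8` scans; a MODEL number). [ours] -/
theorem tauInt_levelObs_flat_twenty {a p q : ℕ → ℝ} (hac : ∀ k, k < 12 → a k = 1 / 5)
    (hP : IsRowStochastic (bdKernel 12 p q)) (hp : ∀ k, k < 12 → p k = a k / 2) (hpK : p 12 = 0) (hq0 : q 0 = 0)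
    (hq : ∀ k, 1 ≤ k → k ≤ 12 → q k = a (k - 1) / 2) :
    asympVar (levelObs 12) (unifLaw 12) (bdKernel 12 p q)
        / (2 * piInner (unifLaw 12) (centred (unifLaw 12) (levelObs 12)) (centred (unifLaw 12) (levelObs 12)))
      = 339 / 2 := by
  rw [tauInt_levelObs_flat (by norm_num : (0 : ℝ) < 1 / 5) hac (by norm_num) hP hp hpK hq0 hq]
  norm_num

end Flat

/-! ## §7 An acceptance band gives a `τ_int` band (the card's per-pair criterion; GEN-7 append)

The functional `Σ_j w_j²/a_j` is antitone in every acceptance, so a per-pair band `m ≤ a_j ≤ M` pins the model index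
`τ_int` between the flat values at `M` and at `m` — the `τ_int` twin of `SwapLadderRoundTrip`'s
`profile_round_trip_card_band`.  CARD-su3-ptbc §3(c) asks `20 ± 5 %` on every pair: then (model)
`(4/5)(K²+2K+2) − 1/2 ≤ τ_int ≤ (4/3)(K²+2K+2) − 1/2`, i.e. `135.5 ≤ τ_int ≤ 226.17` scans for S2's `K = 12`
(flat `20 %`: `169.5`).  Model statements; nothing measured. -/

section Band

variable {K : ℕ} {a : ℕ → ℝ} {p q : ℕ → ℝ}

/-- Lower acceptance bound ⇒ upper bound on the harmonic functional: `a_j ≥ m > 0 ⇒ Σ w_j²/a_j ≤ (Σ w_j²)/m`. [ours] -/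
theorem sum_passageWeight_sq_div_le {m : ℝ} (hm : 0 < m) (ha : ∀ k, k < K → m ≤ a k) :
    ∑ j ∈ range K, passageWeight K j ^ 2 / a j ≤ (∑ j ∈ range K, passageWeight K j ^ 2) / m := by
  rw [sum_div]
  refine sum_le_sum fun j hj => ?_
  exact div_le_div_of_nonneg_left (sq_nonneg _) hm (ha j (mem_range.mp hj))

/-- Upper acceptance bound ⇒ lower bound: `0 < a_j ≤ M ⇒ (Σ w_j²)/M ≤ Σ w_j²/a_j`. [ours] -/
theorem div_le_sum_passageWeight_sq_div {M : ℝ} (ha0 : ∀ k, k < K → 0 < a k) (ha : ∀ k, k < K → a k ≤ M) :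
    (∑ j ∈ range K, passageWeight K j ^ 2) / M ≤ ∑ j ∈ range K, passageWeight K j ^ 2 / a j := by
  rw [sum_div]
  refine sum_le_sum fun j hj => ?_
  have hj' := mem_range.mp hj
  exact div_le_div_of_nonneg_left (sq_nonneg _) (ha0 j hj') (ha j hj')

/-- **`a_j ≥ m` on every pair ⇒ `τ_int ≤ (K²+2K+2)/(5m) − 1/2`** (the flat value at `m`). [ours] -/
theorem tauInt_levelObs_le_of_le_acc {m : ℝ} (hm : 0 < m) (ham : ∀ k, k < K → m ≤ a k) (hK : 1 ≤ K)
    (hP : IsRowStochastic (bdKernel K p q)) (hp : ∀ k, k < K → p k = a k / 2) (hpK : p K = 0) (hq0 : q 0 = 0)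
    (hq : ∀ k, 1 ≤ k → k ≤ K → q k = a (k - 1) / 2) :
    asympVar (levelObs K) (unifLaw K) (bdKernel K p q)
        / (2 * piInner (unifLaw K) (centred (unifLaw K) (levelObs K)) (centred (unifLaw K) (levelObs K)))
      ≤ ((K : ℝ) ^ 2 + 2 * K + 2) / (5 * m) - 1 / 2 := by
  rw [tauInt_levelObs_profile (fun k hk => hm.trans_le (ham k hk)) hK hP hp hpK hq0 hq]
  have hK0 : (0 : ℝ) < K := by exact_mod_cast hK
  have hc : (0 : ℝ) ≤ 6 / ((K : ℝ) * (K + 1) * (K + 2)) := by positivity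
  have h := mul_le_mul_of_nonneg_left (sum_passageWeight_sq_div_le hm ham) hc
  rw [sum_passageWeight_sq] at h
  have e : 6 / ((K : ℝ) * (K + 1) * (K + 2)) * ((K : ℝ) * (K + 1) * (K + 2) * ((K : ℝ) ^ 2 + 2 * K + 2) / 30 / m)
      = ((K : ℝ) ^ 2 + 2 * K + 2) / (5 * m) := by
    field_simp
    ring
  linarith

/-- **`0 < a_j ≤ M` on every pair ⇒ `(K²+2K+2)/(5M) − 1/2 ≤ τ_int`** (the flat value at `M`). [ours] -/
theorem le_tauInt_levelObs_of_acc_le {M : ℝ} (ha0 : ∀ k, k < K → 0 < a k) (haM : ∀ k, k < K → a k ≤ M)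
    (hK : 1 ≤ K) (hP : IsRowStochastic (bdKernel K p q)) (hp : ∀ k, k < K → p k = a k / 2) (hpK : p K = 0)
    (hq0 : q 0 = 0) (hq : ∀ k, 1 ≤ k → k ≤ K → q k = a (k - 1) / 2) :
    ((K : ℝ) ^ 2 + 2 * K + 2) / (5 * M) - 1 / 2 ≤
      asympVar (levelObs K) (unifLaw K) (bdKernel K p q)
        / (2 * piInner (unifLaw K) (centred (unifLaw K) (levelObs K)) (centred (unifLaw K) (levelObs K))) := by
  rw [tauInt_levelObs_profile ha0 hK hP hp hpK hq0 hq]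
  have hK0 : (0 : ℝ) < K := by exact_mod_cast hK
  have hM : 0 < M := (ha0 0 (by omega)).trans_le (haM 0 (by omega))
  have hc : (0 : ℝ) ≤ 6 / ((K : ℝ) * (K + 1) * (K + 2)) := by positivity
  have h := mul_le_mul_of_nonneg_left (div_le_sum_passageWeight_sq_div ha0 haM) hc
  rw [sum_passageWeight_sq] at h
  have e : 6 / ((K : ℝ) * (K + 1) * (K + 2)) * ((K : ℝ) * (K + 1) * (K + 2) * ((K : ℝ) ^ 2 + 2 * K + 2) / 30 / M)
      = ((K : ℝ) ^ 2 + 2 * K + 2) / (5 * M) := by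
    field_simp
    ring
  linarith

/-- **THE CARD's `20 ± 5 %` PER-PAIR CRITERION PINS THE MODEL INDEX `τ_int`**: `3/20 ≤ a_j ≤ 1/4` on every pair ⇒
`(4/5)(K²+2K+2) − 1/2 ≤ τ_int ≤ (4/3)(K²+2K+2) − 1/2`. [ours] -/
theorem tauInt_levelObs_card_band (hlo : ∀ k, k < K → (3 / 20 : ℝ) ≤ a k) (hhi : ∀ k, k < K → a k ≤ 1 / 4)
    (hK : 1 ≤ K) (hP : IsRowStochastic (bdKernel K p q)) (hp : ∀ k, k < K → p k = a k / 2) (hpK : p K = 0)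
    (hq0 : q 0 = 0) (hq : ∀ k, 1 ≤ k → k ≤ K → q k = a (k - 1) / 2) :
    4 / 5 * ((K : ℝ) ^ 2 + 2 * K + 2) - 1 / 2 ≤
        asympVar (levelObs K) (unifLaw K) (bdKernel K p q)
          / (2 * piInner (unifLaw K) (centred (unifLaw K) (levelObs K)) (centred (unifLaw K) (levelObs K))) ∧
      asympVar (levelObs K) (unifLaw K) (bdKernel K p q)
          / (2 * piInner (unifLaw K) (centred (unifLaw K) (levelObs K)) (centred (unifLaw K) (levelObs K)))
        ≤ 4 / 3 * ((K : ℝ) ^ 2 + 2 * K + 2) - 1 / 2 := by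
  have ha0 : ∀ k, k < K → 0 < a k := fun k hk => lt_of_lt_of_le (by norm_num) (hlo k hk)
  constructor
  · have h := le_tauInt_levelObs_of_acc_le ha0 hhi hK hP hp hpK hq0 hq
    have e : ((K : ℝ) ^ 2 + 2 * K + 2) / (5 * (1 / 4)) = 4 / 5 * ((K : ℝ) ^ 2 + 2 * K + 2) := by ring
    linarith
  · have h := tauInt_levelObs_le_of_le_acc (by norm_num : (0 : ℝ) < 3 / 20) hlo hK hP hp hpK hq0 hq
    have e : ((K : ℝ) ^ 2 + 2 * K + 2) / (5 * (3 / 20)) = 4 / 3 * ((K : ℝ) ^ 2 + 2 * K + 2) := by ring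
    linarith

/-- S2's ladder (`K = 12`): the card band gives `135.5 ≤ τ_int ≤ 226.1666…` scans (flat `20 %`: `169.5`). [ours] -/
theorem tauInt_levelObs_card_band_twelve {a p q : ℕ → ℝ} (hlo : ∀ k, k < 12 → (3 / 20 : ℝ) ≤ a k)
    (hhi : ∀ k, k < 12 → a k ≤ 1 / 4) (hP : IsRowStochastic (bdKernel 12 p q))
    (hp : ∀ k, k < 12 → p k = a k / 2) (hpK : p 12 = 0) (hq0 : q 0 = 0)
    (hq : ∀ k, 1 ≤ k → k ≤ 12 → q k = a (k - 1) / 2) :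
    (271 / 2 : ℝ) ≤ asympVar (levelObs 12) (unifLaw 12) (bdKernel 12 p q)
          / (2 * piInner (unifLaw 12) (centred (unifLaw 12) (levelObs 12)) (centred (unifLaw 12) (levelObs 12))) ∧
      asympVar (levelObs 12) (unifLaw 12) (bdKernel 12 p q)
          / (2 * piInner (unifLaw 12) (centred (unifLaw 12) (levelObs 12)) (centred (unifLaw 12) (levelObs 12)))
        ≤ 1357 / 6 := by
  obtain ⟨h1, h2⟩ := tauInt_levelObs_card_band hlo hhi (by norm_num) hP hp hpK hq0 hq
  constructor
  · norm_num at h1 ⊢; linarith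
  · norm_num at h2 ⊢; linarith

end Band

end Summit.Ventures.LatticeQCDFlow.Scaling
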